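import Summits.CriticalPhenomena.SAWScalingLimit.Theses.SAWInfinitesimalRigidity

/-!
# Route `SAWInfinitesimalRigidity`: the assembly frame `Assembly` (stmt-CriticalPhenomena-10515)

The assembly item of the route (route repair 2026-08-15) is

  `Assembly := LocalRigidity → GlobalFromLocal → AxiomsOfLimit → LimitExists → LSWRestrictionFact83 →
    SAWScalingLimit`,

which is literally the type of the route's certified deciding theorem
`Summit.CriticalPhenomena.SAWScalingLimit.Theses.SAWInfinitesimalRigidity.closes` (take the full
scaling limit `P` from `LimitExists`; `AxiomsOfLimit` gives restriction, the restriction-coupled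
Markov kernel, reversibility, lattice-similarity and conjugation covariance, simplicity;
`GlobalFromLocal` fed `LocalRigidity` gives conformal covariance; `LSWRestrictionFact83`
identifies `P D` as the chordal SLE(8/3) law; `MeasureTheory.integral_map` transports the limit).
This file closes the item by that theorem; no new definitions, no named-fact hypotheses.

## References

* G. Lawler, O. Schramm, W. Werner, *Conformal restriction: the chordal case*, J. Amer. Math.
  Soc. 16 (2003) [LawlerSchrammWerner2003Restriction].
* G. Lawler, O. Schramm, W. Werner, *On the scaling limit of planar self-avoiding walk*, Proc.
  Sympos. Pure Math. 72 (2004) [LawlerSchrammWerner2004SAW].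
-/

namespace Summit.CriticalPhenomena.SAWScalingLimit.Theorems

/-- **Item `stmt-CriticalPhenomena-10515` (`SAWInfinitesimalRigidity.Assembly`):
`LocalRigidity → GlobalFromLocal → AxiomsOfLimit → LimitExists → LSWRestrictionFact83 →
SAWScalingLimit`** — exactly the route's deciding theorem `closes`: the scaling limit `P`
(LimitExists) inherits the lattice-exact axioms (AxiomsOfLimit), is conformally covariant
(GlobalFromLocal applied to LocalRigidity), hence is chordal SLE(8/3) in every Dobrushin domain
(LSWRestrictionFact83), and `integral_map` turns convergence in law to `P D` into convergence in
law to the SLE(8/3) curve.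
[cite: LawlerSchrammWerner2003Restriction, p.5 result 2] -/
theorem sawInfinitesimalRigidity_assembly_proof : Theses.SAWInfinitesimalRigidity.Assembly := by
  unfold Theses.SAWInfinitesimalRigidity.Assembly
  exact Theses.SAWInfinitesimalRigidity.closes

end Summit.CriticalPhenomena.SAWScalingLimit.Theorems
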